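import Summits.HodgeConjecture.HodgeConjecture.Theorems.R90S7QsRigidCoreAtOfS5                 -- ★ (this seat, JQ-S7-C1′) `qsRigidCoreAt_of_S5`: the PER-DATUM junction from S5's (QS-R♯) ∕ (QS-T) types
import Summits.HodgeConjecture.HodgeConjecture.Theorems.R90S7ConjugatorSimilitude                   -- ★ p862548 (L0) `exists_formCongr_of_conj`: a conjugator `ψ_v` IS a form congruence `e_S⁻¹`
import Summits.HodgeConjecture.HodgeConjecture.Theorems.R90S7RigidCoreTransport                     -- ★ p862551: `exists_transportAPackets_xiPacketFamilyOfRecordSCD_eq`, `charIdentityAtTest_transport_of_frames`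
import Summits.HodgeConjecture.HodgeConjecture.Theorems.R90S9CongrOrbitalMeasureTransport            -- ★ S9: `isCanonical_transport_cmDatumLocalCongr_symm`, `isMulRightInvariant_map_cmDatumLocalCongr_symm`
import Summits.HodgeConjecture.HodgeConjecture.Theorems.R90S9SignedPackageCongrTransport             -- ★ S9 p03: `cmCharIdentityPackageTestSigned_transport_formCongr` (the SIGNED Q-package rides a family of H-frames)
import Summits.HodgeConjecture.HodgeConjecture.Theorems.R90S3SplitTransferExistsTransport            -- ★ S3 p06: `isLocalDeltaTransferExists_finExplicit_transport_iff_formSignAt` ((T_v) rides a frame, every finite place)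
import Summits.HodgeConjecture.HodgeConjecture.Theorems.F0P3SpectralPacketTransport                  -- ★ (N) 3f: `transportAPackets` (+ ★ `F0P3InnerFormClassificationV6.splitForm`, `Places`)
import Summits.HodgeConjecture.HodgeConjecture.Theorems.F0P3XiEvpOfRecordSCDSigned                  -- ★ `hSCD_of_cmCharIdentityPackageTestSigned`, `charIdentityAtTestSigned_hSCD` (the record's datum read off the SIGNED test package)
import Literature.NumberTheory.Rogawski1990.LocalTransferExistence                             -- ★ (H₇) `IsLocalDeltaTransferExists`
import HarnessLib

/-!
# R90-TF · S7 (Ch. 14.6-tuple, C146) · O2′ FROM S5 — `pkRigidCore_of_S5`: the leaf's ORGAN 2 (rigid core, Thm. 13.3.6 (c) finite part, kit-free) from S5's (QS-R♯) ∕ (QS-T)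
# socket TYPES and floor (E1-a′) AT `H` — the package «Q♯@Φ₃» is TRANSPORTED from the letter's own `hQ`, not socketed
# ([Rogawski1990, §13.3 Thm. 13.3.6 (c), Thm. 13.3.5 p. 202; §13.1 Prop. 13.1.4 p. 199; §14.1–14.2 pp. 232–234; §4.9 Prop. 4.9.1 (a) p. 55])

Cell `hodgecm-mathlib`, crux H413 (`stmt-HodgeConjecture-24833`), route of record `HCCMUnconditional`; programme R90-TF (brief `director/R90-BRIEF.v2.md`
1f40d54518340a35), section S7 = Rogawski §14.6 (base `R90-C146`), seat R90-C146-p01 (g3); S7 pen LH7-plan (g5) RULING S7-R23 (JQ-S7-C1 booked) + this seat's plan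
2026-09-05T04:27Z «ONE SOCKET FEWER».  Helper file, lane `--supports stmt-HodgeConjecture-24833 --as helper`; ONE theorem; no `def`, no instance, no notation, no `sorry`;
`Theorems` + `Literature` imports only.

THE STATEMENT = ★ `pkRigidCore_of_qsRigidCore` (`Theorems/R90S7RigidCoreOfQsRigidity.lean`, the O2′ junction) with its hypothesis `(hQS : ∀ L, QsRigidCore L)` REPLACED by
S5's two socket TYPES `hRig` (QS-R♯, = body of `R90.S5.SocketQsXiRigiditySharp`, S5 D a27b7cdb28f5b7c9 :275–:342) ∕ `hAe` (QS-T, = body of `R90.S5.SocketQsFiniteTriggerMembership`,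
:432–:456) BYTE FOR BYTE, and ONE binder INSERTED after `hcan`: «(T_v)@H» — `∀ v, nonsplit v → IsLocalDeltaTransferExists L H v (Δ‴_H v) (mH v) (mG v) IsLocSmooth IsLocSmooth`,
the floor (E1-a′) predicate family in the H-currency that S3 (`R90_S3_EndoCharIdentityA` :105 …) and S4 already bind («no new owner», S6 ledger ED. 3b).  Everything else —
frame, Haar data, `hquad`, canonical `mH mG`, `ψ` with `hψ`, `μG`, the SIGNED package `hQ` on `U(H)`, `hK`, and the conclusion (O2′'s RIGID-CORE clause over
`transportAPackets ψ Rec_H`) — is O2′'s text token for token.  NO «Q♯@Φ₃» hypothesis: the Φ₃-side package at the manufactured data is `hQ` transported.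

THE PROOF = O2′'s ★ proof (pure transport along `ψ_v = e_S⁻¹`, [§14.1–14.2]) with the ∀-closed letter replaced by the ★ PER-DATUM junction `qsRigidCoreAt_of_S5 hRig hAe L`
at the manufactured data `(Δ‴_{Φ₃}, m_H, e_S⁻¹_* m_G, e_S⁻¹_* ν_G, ν_H)`, fed with: «Q♯ at the datum» := ★ S9 `cmCharIdentityPackageTestSigned_transport_formCongr … S m hm hσm h' … hQ`
(non-split clauses: product frames + sign constancy; split clauses: the split packet rides the congruence); «(T_v) at the datum» := ★ S3
`isLocalDeltaTransferExists_finExplicit_transport_iff_formSignAt … (S w) …` applied to «(T_v)@H»; the pinned datum `hSC₀` and its identity exactly as in O2′.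

HONEST LABEL: a junction theorem closes no citation; it converts the leaf's organ O2′ into {S5's two print sockets (QS-R♯), (QS-T) + floor (E1-a′) at `H`}; REL ≠ ★ ≠ BUILT.
HC_CM is proved only modulo the 7 printed citations (2 remaining named inputs: hLiu418 = stmt-HodgeConjecture-24832, h413 = stmt-HodgeConjecture-24833) — until rung 0 closes.

## References
* [Rogawski1990] J. D. Rogawski, *Automorphic Representations of Unitary Groups in Three Variables*, Ann. of Math. Stud. 123 (1990): §13.3 Thm. 13.3.5,
  Thm. 13.3.6 (c) p. 202; §13.1 Prop. 13.1.3 (d), Prop. 13.1.4 p. 199; §12.2 (2) pp. 173–174; §14.1–§14.2 pp. 232–234; §14.6 p. 242; §4.9 Prop. 4.9.1 (a) p. 55.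
* [BushnellHenniart2006] C. J. Bushnell, G. Henniart, *The Local Langlands Conjecture for GL(2)*, Grundlehren 335 (2006), §1.1.
* [LanglandsShelstad1987] R. P. Langlands, D. Shelstad, *On the definition of transfer factors*, Math. Ann. 278 (1987), §1, §4.2.
-/

set_option autoImplicit false
-- the mandated namespace repeats the single-problem summit's segment (`HodgeConjecture.HodgeConjecture`)
set_option linter.dupNamespace false

noncomputable section

open NumberField IsDedekindDomain MeasureTheory
open scoped Matrix MatrixGroups

namespace Summit.HodgeConjecture.HodgeConjecture.R90.S7

open Literature.NumberTheory Literature.NumberTheory.Automorphic Literature.NumberTheory.Automorphic.UnitaryGroup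
open Literature.NumberTheory.Rogawski1990 Literature.NumberTheory.GaloisRepresentations
open Summit.HodgeConjecture.HodgeConjecture.Cruxes.H413
open Summit.HodgeConjecture.HodgeConjecture.Cruxes.H413.F0P3InnerFormClassificationV6 (splitForm Places)
open Summit.HodgeConjecture.HodgeConjecture.Cruxes.H413.F0P3XiPacketFamilyOfRecord (keysOfKeysCaseTwo)
open Summit.HodgeConjecture.HodgeConjecture.Cruxes.H413.F0P3XiPacketFamilyOfRecordSCD (xiPacketFamilyOfRecordSCD hSCD_of_cmCharIdentityPackageTestSigned
  charIdentityAtTestSigned_hSCD)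
open Summit.HodgeConjecture.HodgeConjecture.Cruxes.H413.F0P3SpectralPacket (transportAPackets)

/-! ## The O2′ junction from S5's sockets -/

open scoped Classical in
set_option synthInstance.maxHeartbeats 400000 in
set_option maxHeartbeats 8000000 in
/-- **O2′ FROM S5 — `pkRigidCore_of_S5`**: the leaf's ORGAN 2 `F0U3LettersRung1.PKrigidCoreLetter` (ED. 6, O2′: Thm. 13.3.6 (c), finite part, kit-free, over the transported
record `transportAPackets ψ Rec_H`) with ONE extra binder «(T_v)@H» (floor (E1-a′): local Δ‴_H-transfer exists at the non-split places, Prop. 4.9.1 (a)), FROM `hRig` = the TYPE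
of S5's (QS-R♯) socket `stub_R90_1335_qsXiRigiditySharp` (Thm. 13.3.5 + Prop. 13.1.3 (d)) and `hAe` = the TYPE of S5's (QS-T) socket `stub_R90_1336c_qsFinMembership` (Thm.
13.3.6 (c)).  Proof: O2′'s transport [§14.1–14.2] — `ψ_v = e_S⁻¹` (★ L0), the transported H-record IS the Φ₃-record for the transported datum `hSC₀` (★), print's Φ₃-side data
manufactured from the frame — then the ★ per-datum junction `qsRigidCoreAt_of_S5` at those data, its «Q♯ at the datum» being the letter's own `hQ` TRANSPORTED (★ S9
`cmCharIdentityPackageTestSigned_transport_formCongr`) and its «(T_v) at the datum» being «(T_v)@H» TRANSPORTED (★ S3 `isLocalDeltaTransferExists_finExplicit_transport_iff_formSignAt`).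
No «Q♯@Φ₃» hypothesis, no def. [cite: Rogawski1990, §13.3 Thm. 13.3.6 (c), Thm. 13.3.5 p. 202; §13.1 Prop. 13.1.4 p. 199; §14.1–14.2 pp. 232–234; §4.9 Prop. 4.9.1 (a) p. 55]
[cite: BushnellHenniart2006, §1.1] [cite: LanglandsShelstad1987, §1] -/
theorem pkRigidCore_of_S5
    -- (R-rig) the TYPE of S5's socket (QS-R♯) `R90.S5.stub_R90_1335_qsXiRigiditySharp` = body of `R90.S5.SocketQsXiRigiditySharp` (S5 D :275–:342) BYTE FOR BYTE
    (hRig :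
      ∀ (L : Type) [Field L] [NumberField L] [IsCMField L]
        [∀ v : HeightOneSpectrum (𝓞 ↥(maximalRealSubfield L)), MeasurableSpace ((cmDatum L 3 (qsForm L)).Local v)]
        [∀ v : HeightOneSpectrum (𝓞 ↥(maximalRealSubfield L)),
          MeasurableSpace ((cmDatum L 2 (Matrix.of fun i j : Fin 2 => if i.val + j.val + 1 = 2 then (1 : L) else 0)).Local v ×
            (cmDatum L 1 (Matrix.of fun i j : Fin 1 => if i.val + j.val + 1 = 1 then (1 : L) else 0)).Local v)]
        [∀ (v : HeightOneSpectrum (𝓞 ↥(maximalRealSubfield L)))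
            (a : ((cmDatum L 2 (Matrix.of fun i j : Fin 2 => if i.val + j.val + 1 = 2 then (1 : L) else 0)).Local v ×
              (cmDatum L 1 (Matrix.of fun i j : Fin 1 => if i.val + j.val + 1 = 1 then (1 : L) else 0)).Local v)),
          MeasurableSpace (((cmDatum L 2 (Matrix.of fun i j : Fin 2 => if i.val + j.val + 1 = 2 then (1 : L) else 0)).Local v ×
              (cmDatum L 1 (Matrix.of fun i j : Fin 1 => if i.val + j.val + 1 = 1 then (1 : L) else 0)).Local v) ⧸
            Subgroup.centralizer ({a} : Set ((cmDatum L 2 (Matrix.of fun i j : Fin 2 => if i.val + j.val + 1 = 2 then (1 : L) else 0)).Local v ×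
              (cmDatum L 1 (Matrix.of fun i j : Fin 1 => if i.val + j.val + 1 = 1 then (1 : L) else 0)).Local v)))]
        [∀ (v : HeightOneSpectrum (𝓞 ↥(maximalRealSubfield L))) (γ : (cmDatum L 3 (qsForm L)).Local v),
          MeasurableSpace ((cmDatum L 3 (qsForm L)).Local v ⧸ Subgroup.centralizer ({γ} : Set ((cmDatum L 3 (qsForm L)).Local v)))]
        (Δ : ∀ v : HeightOneSpectrum (𝓞 ↥(maximalRealSubfield L)), LocalTransferFactor L (qsForm L) v)
        (mH : ∀ v : HeightOneSpectrum (𝓞 ↥(maximalRealSubfield L)),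
          OrbitalMeasureFamily ((cmDatum L 2 (Matrix.of fun i j : Fin 2 => if i.val + j.val + 1 = 2 then (1 : L) else 0)).Local v ×
            (cmDatum L 1 (Matrix.of fun i j : Fin 1 => if i.val + j.val + 1 = 1 then (1 : L) else 0)).Local v))
        (mG : ∀ v : HeightOneSpectrum (𝓞 ↥(maximalRealSubfield L)), OrbitalMeasureFamily ((cmDatum L 3 (qsForm L)).Local v))
        (νG : ∀ v : HeightOneSpectrum (𝓞 ↥(maximalRealSubfield L)), Measure ((cmDatum L 3 (qsForm L)).Local v))
        (νH : ∀ v : HeightOneSpectrum (𝓞 ↥(maximalRealSubfield L)),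
          Measure ((cmDatum L 2 (Matrix.of fun i j : Fin 2 => if i.val + j.val + 1 = 2 then (1 : L) else 0)).Local v ×
            (cmDatum L 1 (Matrix.of fun i j : Fin 1 => if i.val + j.val + 1 = 1 then (1 : L) else 0)).Local v))
        [∀ v : HeightOneSpectrum (𝓞 ↥(maximalRealSubfield L)), BorelSpace ((cmDatum L 3 (qsForm L)).Local v)]
        [∀ v : HeightOneSpectrum (𝓞 ↥(maximalRealSubfield L)),
          BorelSpace ((cmDatum L 2 (Matrix.of fun i j : Fin 2 => if i.val + j.val + 1 = 2 then (1 : L) else 0)).Local v ×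
            (cmDatum L 1 (Matrix.of fun i j : Fin 1 => if i.val + j.val + 1 = 1 then (1 : L) else 0)).Local v)]
        [∀ (v : HeightOneSpectrum (𝓞 ↥(maximalRealSubfield L)))
            (a : ((cmDatum L 2 (Matrix.of fun i j : Fin 2 => if i.val + j.val + 1 = 2 then (1 : L) else 0)).Local v ×
              (cmDatum L 1 (Matrix.of fun i j : Fin 1 => if i.val + j.val + 1 = 1 then (1 : L) else 0)).Local v)),
          BorelSpace (((cmDatum L 2 (Matrix.of fun i j : Fin 2 => if i.val + j.val + 1 = 2 then (1 : L) else 0)).Local v ×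
              (cmDatum L 1 (Matrix.of fun i j : Fin 1 => if i.val + j.val + 1 = 1 then (1 : L) else 0)).Local v) ⧸
            Subgroup.centralizer ({a} : Set ((cmDatum L 2 (Matrix.of fun i j : Fin 2 => if i.val + j.val + 1 = 2 then (1 : L) else 0)).Local v ×
              (cmDatum L 1 (Matrix.of fun i j : Fin 1 => if i.val + j.val + 1 = 1 then (1 : L) else 0)).Local v)))]
        [∀ (v : HeightOneSpectrum (𝓞 ↥(maximalRealSubfield L))) (γ : (cmDatum L 3 (qsForm L)).Local v),
          BorelSpace ((cmDatum L 3 (qsForm L)).Local v ⧸ Subgroup.centralizer ({γ} : Set ((cmDatum L 3 (qsForm L)).Local v)))]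
        [∀ v, (νG v).IsHaarMeasure] [∀ v, (νG v).IsMulRightInvariant] [∀ v, (νH v).IsHaarMeasure] [∀ v, (νH v).IsMulRightInvariant],
        ∀ (μω : HeckeCharacter L) (hμu : μω.IsUnitary),
        (∀ x : Literature.NumberTheory.GaloisRepresentations.ideleGroup ↥(maximalRealSubfield L),
          μω (AdeleRing.ideleBaseChange (↥(maximalRealSubfield L)) L x) = quadraticHeckeCharCM L x) →
        Δ = finExplicitCollection L (qsForm L) μω (finExplicitDelta_conj_left_all L (qsForm L) μω) (finExplicitDelta_conj_right_all L (qsForm L) μω) →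
        (∀ v : HeightOneSpectrum (𝓞 ↥(maximalRealSubfield L)), (mH v).IsCanonical (IsLocalGRegular L v) (νH v) ∧
          (mG v).IsCanonical (fun γ => IsRegularElt (γ.val : GL (Fin 3) (UnitaryGroup.LocalRing L v))) (νG v)) →
        ∀ (hQS : CMCharIdentityPackageTestSigned L (qsForm L) (F0P3cStCharTSCharField.qsForm_map_cmConjRingHom_transpose L) (F0P3cStCharTSShellOrbitalG.isUnit_det_qsForm L) νH νG μω hμu Δ mH mG),
        (∀ v : HeightOneSpectrum (𝓞 ↥(maximalRealSubfield L)), (∀ w : PlacesOver L v, IsCMField.complexConj L • w.1 = w.1) →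
          IsLocalDeltaTransferExists L (qsForm L) v (Δ v) (mH v) (mG v) Literature.NumberTheory.Rogawski1990.IsLocSmooth
            Literature.NumberTheory.Rogawski1990.IsLocSmooth) →
        ∀ (ξ : OneDimAutRepH L)
          (μA : Measure (adelicGroupData (↥(maximalRealSubfield L)) L (IsCMField.complexConj L) 3 (qsForm L)).automorphicQuotient)
          [(adelicGroupData (↥(maximalRealSubfield L)) L (IsCMField.complexConj L) 3 (qsForm L)).IsAutomorphicMeasure μA]
          (P : DiscreteAutomorphicRep (adelicGroupData (↥(maximalRealSubfield L)) L (IsCMField.complexConj L) 3 (qsForm L)) μA),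
          MemXiFamily P (F0P3cStCharTSCharField.qsForm_map_cmConjRingHom_transpose L) (F0P3cStCharTSShellOrbitalG.isUnit_det_qsForm L) μω hμu ξ →
          ∀ (v : HeightOneSpectrum (𝓞 ↥(maximalRealSubfield L))) (hns : ∀ w : PlacesOver L v, IsCMField.complexConj L • w.1 = w.1),
          ∀ (T : GL (Fin 3) (LocalRing L v)) (a : LocalRing L v) (ha : IsUnit a)
            (h : formCongr (conjLocal L (IsCMField.complexConj L) v) T ((qsForm L).map (algebraMap L (LocalRing L v))) =
              a • (Matrix.of fun i j : Fin 3 => if i.val + j.val + 1 = 3 then (1 : L) else 0).map (algebraMap L (LocalRing L v))),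
          ∀ [MeasurableSpace (Gqs L v ⧸ Subgroup.center (Gqs L v))] [BorelSpace (Gqs L v ⧸ Subgroup.center (Gqs L v))]
            (μZ : Measure (Gqs L v ⧸ Subgroup.center (Gqs L v))) [μZ.IsHaarMeasure],
          ∀ (π2 πn : IrrClass (Gqs L v)),
          ∀ (hK : KeysCaseTwoLabels L v (μω.semilocalComponent L v) (torusLocalComponent L (IsCMField.complexConj L) v ξ.η)
              (torusLocalComponent L (IsCMField.complexConj L) v ξ.ψ) π2 πn)
            (hn : ¬ πn.IsSquareIntegrable μZ),
            -- (QS-R♯) «13.3.5∕13.3.6 RIGIDITY ON U(Φ₃), SHARP»: every v-constituent of P is πⁿ ∘ e or the πˢ(ξ_v) ∘ e of `hQS` (no π² ∘ e)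
            ∀ c : IrrClass ((cmDatum L 3 (qsForm L)).Local v),
              (IrrClass.comap (localPiEquiv L (IsCMField.complexConj L) 3 (qsForm L) v) c).IsConstituentOf
                  (P.finRep.smoothPart.toRepresentation.comp (inclPlace (↥(maximalRealSubfield L)) L (IsCMField.complexConj L) 3 (qsForm L) v)) →
              c = IrrClass.comap (cmDatumLocalCongr L v T ha h).symm πn ∨
                c = ((hQS ξ).1 v hns T a ha h μZ π2 πn hK hn).πs)
    -- (R-ae) the TYPE of S5's socket (QS-T) `R90.S5.stub_R90_1336c_qsFinMembership` = body of `R90.S5.SocketQsFiniteTriggerMembership` (S5 D :432–:456) BYTE FOR BYTE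
    (hAe :
      ∀ (L : Type) [Field L] [NumberField L] [IsCMField L]
        (μω : HeckeCharacter L) (hμu : μω.IsUnitary),
        (∀ x : Literature.NumberTheory.GaloisRepresentations.ideleGroup ↥(maximalRealSubfield L),
          μω (AdeleRing.ideleBaseChange (↥(maximalRealSubfield L)) L x) = quadraticHeckeCharCM L x) →
        ∀ (ξ : OneDimAutRepH L)
          (μA : Measure (adelicGroupData (↥(maximalRealSubfield L)) L (IsCMField.complexConj L) 3 (qsForm L)).automorphicQuotient)
          [(adelicGroupData (↥(maximalRealSubfield L)) L (IsCMField.complexConj L) 3 (qsForm L)).IsAutomorphicMeasure μA]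
          (P : DiscreteAutomorphicRep (adelicGroupData (↥(maximalRealSubfield L)) L (IsCMField.complexConj L) 3 (qsForm L)) μA),
          ∀ (v : HeightOneSpectrum (𝓞 ↥(maximalRealSubfield L))) (hns : ∀ w : PlacesOver L v, IsCMField.complexConj L • w.1 = w.1),
          ∀ (T : GL (Fin 3) (LocalRing L v)) (a : LocalRing L v) (ha : IsUnit a)
            (h : formCongr (conjLocal L (IsCMField.complexConj L) v) T ((qsForm L).map (algebraMap L (LocalRing L v))) =
              a • (Matrix.of fun i j : Fin 3 => if i.val + j.val + 1 = 3 then (1 : L) else 0).map (algebraMap L (LocalRing L v))),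
          ∀ [MeasurableSpace (Gqs L v ⧸ Subgroup.center (Gqs L v))] [BorelSpace (Gqs L v ⧸ Subgroup.center (Gqs L v))]
            (μZ : Measure (Gqs L v ⧸ Subgroup.center (Gqs L v))) [μZ.IsHaarMeasure],
          ∀ (π2 πn : IrrClass (Gqs L v)),
          ∀ (hK : KeysCaseTwoLabels L v (μω.semilocalComponent L v) (torusLocalComponent L (IsCMField.complexConj L) v ξ.η)
              (torusLocalComponent L (IsCMField.complexConj L) v ξ.ψ) π2 πn)
            (hn : ¬ πn.IsSquareIntegrable μZ),
            -- (QS-T) «13.3.6 (c) FINITE TRIGGER»: some v-constituent of P is πⁿ(ξ_v) ∘ e  ⟹  P lies in the ξ′-envelope of SOME one-dimensional ξ′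
            (∃ c : IrrClass ((cmDatum L 3 (qsForm L)).Local v),
              (IrrClass.comap (localPiEquiv L (IsCMField.complexConj L) 3 (qsForm L) v) c).IsConstituentOf
                  (P.finRep.smoothPart.toRepresentation.comp (inclPlace (↥(maximalRealSubfield L)) L (IsCMField.complexConj L) 3 (qsForm L) v)) ∧
                c = IrrClass.comap (cmDatumLocalCongr L v T ha h).symm πn) →
            ∃ ξ' : OneDimAutRepH L,
              MemXiFamily P (F0P3cStCharTSCharField.qsForm_map_cmConjRingHom_transpose L) (F0P3cStCharTSShellOrbitalG.isUnit_det_qsForm L) μω hμu ξ')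
    (L : Type) [Field L] [NumberField L] [IsCMField L] (H : Matrix (Fin 3) (Fin 3) L)
    (hH : (H.map (cmConjRingHom L))ᵀ = H) (hHd : IsUnit H.det) (μω : HeckeCharacter L) (hμu : μω.IsUnitary)
    (hμω : ∀ x : Literature.NumberTheory.GaloisRepresentations.ideleGroup ↥(maximalRealSubfield L),
      μω (AdeleRing.ideleBaseChange (↥(maximalRealSubfield L)) L x) = quadraticHeckeCharCM L x)
    (νH : ∀ v : Places L, @Measure
      ((cmDatum L 2 (Matrix.of fun i j : Fin 2 => if i.val + j.val + 1 = 2 then (1 : L) else 0)).Local v ×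
        (cmDatum L 1 (Matrix.of fun i j : Fin 1 => if i.val + j.val + 1 = 1 then (1 : L) else 0)).Local v) (borel _))
    (νG : ∀ v : Places L, @Measure ((cmDatum L 3 H).Local v) (borel _))
    (μZ : ∀ v : Places L, @Measure (Gqs L v ⧸ Subgroup.center (Gqs L v)) (borel _))
    (isHaar_νH : ∀ v : Places L, letI : MeasurableSpace (
      (cmDatum L 2 (Matrix.of fun i j : Fin 2 => if i.val + j.val + 1 = 2 then (1 : L) else 0)).Local v ×
        (cmDatum L 1 (Matrix.of fun i j : Fin 1 => if i.val + j.val + 1 = 1 then (1 : L) else 0)).Local v) := borel _; (νH v).IsHaarMeasure)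
    (isRightInv_νH : ∀ v : Places L, letI : MeasurableSpace (
      (cmDatum L 2 (Matrix.of fun i j : Fin 2 => if i.val + j.val + 1 = 2 then (1 : L) else 0)).Local v ×
        (cmDatum L 1 (Matrix.of fun i j : Fin 1 => if i.val + j.val + 1 = 1 then (1 : L) else 0)).Local v) := borel _; (νH v).IsMulRightInvariant)
    (isHaar_νG : ∀ v : Places L, letI : MeasurableSpace ((cmDatum L 3 H).Local v) := borel _; (νG v).IsHaarMeasure)
    (isRightInv_νG : ∀ v : Places L, letI : MeasurableSpace ((cmDatum L 3 H).Local v) := borel _; (νG v).IsMulRightInvariant)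
    (isHaar_μZ : ∀ v : Places L, letI : MeasurableSpace (Gqs L v ⧸ Subgroup.center (Gqs L v)) := borel _; (μZ v).IsHaarMeasure)
    (hquad : ∀ v : Places L, (∀ w : PlacesOver L v, IsCMField.complexConj L • w.1 = w.1) →
      IsQuadraticCharExtension (conjLocal L (IsCMField.complexConj L) v) (μω.semilocalComponent L v)) :
    letI : ∀ (v : Places L) (a : (cmDatum L 2 (Matrix.of fun i j : Fin 2 => if i.val + j.val + 1 = 2 then (1 : L) else 0)).Local v ×
        (cmDatum L 1 (Matrix.of fun i j : Fin 1 => if i.val + j.val + 1 = 1 then (1 : L) else 0)).Local v),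
      MeasurableSpace (((cmDatum L 2 (Matrix.of fun i j : Fin 2 => if i.val + j.val + 1 = 2 then (1 : L) else 0)).Local v ×
          (cmDatum L 1 (Matrix.of fun i j : Fin 1 => if i.val + j.val + 1 = 1 then (1 : L) else 0)).Local v) ⧸
        Subgroup.centralizer ({a} : Set ((cmDatum L 2 (Matrix.of fun i j : Fin 2 => if i.val + j.val + 1 = 2 then (1 : L) else 0)).Local v ×
          (cmDatum L 1 (Matrix.of fun i j : Fin 1 => if i.val + j.val + 1 = 1 then (1 : L) else 0)).Local v))) := fun _ _ => borel _
    letI : ∀ (v : Places L) (γ : (cmDatum L 3 H).Local v),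
        MeasurableSpace ((cmDatum L 3 H).Local v ⧸ Subgroup.centralizer ({γ} : Set ((cmDatum L 3 H).Local v))) := fun _ _ => borel _
    haveI : ∀ (v : Places L) (a : (cmDatum L 2 (Matrix.of fun i j : Fin 2 => if i.val + j.val + 1 = 2 then (1 : L) else 0)).Local v ×
        (cmDatum L 1 (Matrix.of fun i j : Fin 1 => if i.val + j.val + 1 = 1 then (1 : L) else 0)).Local v),
      BorelSpace (((cmDatum L 2 (Matrix.of fun i j : Fin 2 => if i.val + j.val + 1 = 2 then (1 : L) else 0)).Local v ×
          (cmDatum L 1 (Matrix.of fun i j : Fin 1 => if i.val + j.val + 1 = 1 then (1 : L) else 0)).Local v) ⧸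
        Subgroup.centralizer ({a} : Set ((cmDatum L 2 (Matrix.of fun i j : Fin 2 => if i.val + j.val + 1 = 2 then (1 : L) else 0)).Local v ×
          (cmDatum L 1 (Matrix.of fun i j : Fin 1 => if i.val + j.val + 1 = 1 then (1 : L) else 0)).Local v))) := fun _ _ => ⟨rfl⟩
    haveI : ∀ (v : Places L) (γ : (cmDatum L 3 H).Local v),
        BorelSpace ((cmDatum L 3 H).Local v ⧸ Subgroup.centralizer ({γ} : Set ((cmDatum L 3 H).Local v))) := fun _ _ => ⟨rfl⟩
    ∀ (mH : ∀ v : Places L, OrbitalMeasureFamily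
        ((cmDatum L 2 (Matrix.of fun i j : Fin 2 => if i.val + j.val + 1 = 2 then (1 : L) else 0)).Local v ×
          (cmDatum L 1 (Matrix.of fun i j : Fin 1 => if i.val + j.val + 1 = 1 then (1 : L) else 0)).Local v))
      (mG : ∀ v : Places L, OrbitalMeasureFamily ((cmDatum L 3 H).Local v)),
      letI : ∀ v : Places L, MeasurableSpace ((cmDatum L 3 H).Local v) := fun _ => borel _
      haveI : ∀ v : Places L, BorelSpace ((cmDatum L 3 H).Local v) := fun _ => ⟨rfl⟩
      letI : ∀ v : Places L, MeasurableSpace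
        ((cmDatum L 2 (Matrix.of fun i j : Fin 2 => if i.val + j.val + 1 = 2 then (1 : L) else 0)).Local v ×
          (cmDatum L 1 (Matrix.of fun i j : Fin 1 => if i.val + j.val + 1 = 1 then (1 : L) else 0)).Local v) := fun _ => borel _
      haveI : ∀ v : Places L, BorelSpace
        ((cmDatum L 2 (Matrix.of fun i j : Fin 2 => if i.val + j.val + 1 = 2 then (1 : L) else 0)).Local v ×
          (cmDatum L 1 (Matrix.of fun i j : Fin 1 => if i.val + j.val + 1 = 1 then (1 : L) else 0)).Local v) := fun _ => ⟨rfl⟩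
      haveI : ∀ v : Places L, (νH v).IsHaarMeasure := isHaar_νH
      haveI : ∀ v : Places L, (νH v).IsMulRightInvariant := isRightInv_νH
      haveI : ∀ v : Places L, (νG v).IsHaarMeasure := isHaar_νG
      haveI : ∀ v : Places L, (νG v).IsMulRightInvariant := isRightInv_νG
      (∀ v : Places L, (mH v).IsCanonical (IsLocalGRegular L v) (νH v) ∧
          (mG v).IsCanonical (fun γ => IsRegularElt (γ.val : GL (Fin 3) (UnitaryGroup.LocalRing L v))) (νG v)) →
      -- «(T_v)@H» (NEW binder, floor (E1-a′) in the H-currency the S3 ∕ S4 sockets bind): local Δ‴_H-transfer EXISTS at the non-split places [Prop. 4.9.1 (a)]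
      (∀ v : Places L, (∀ w : PlacesOver L v, IsCMField.complexConj L • w.1 = w.1) →
        IsLocalDeltaTransferExists L H v
          ((finExplicitCollection L H μω (finExplicitDelta_conj_left_all L H μω) (finExplicitDelta_conj_right_all L H μω)) v) (mH v) (mG v)
          Literature.NumberTheory.Rogawski1990.IsLocSmooth Literature.NumberTheory.Rogawski1990.IsLocSmooth) →
      ∀ (ψ : ∀ v : Places L, (cmDatum L 3 H).Local v ≃ₜ* (cmDatum L 3 (splitForm L 3)).Local v)
        (_hψ : ∀ v : Places L, ∃ S : GL (Fin 3) (UnitaryGroup.LocalRing L v),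
          ∀ g : (cmDatum L 3 H).Local v, ((ψ v g).val : GL (Fin 3) (UnitaryGroup.LocalRing L v)) = S⁻¹ * g.val * S)
        (μG : Measure (cmDatum L 3 (splitForm L 3)).automorphicQuotient)
        (hAutG : (cmDatum L 3 (splitForm L 3)).IsAutomorphicMeasure μG)
        (hQ : CMCharIdentityPackageTestSigned L H hH hHd νH νG μω hμu
          (finExplicitCollection L H μω (finExplicitDelta_conj_left_all L H μω) (finExplicitDelta_conj_right_all L H μω)) mH mG)
        (hK : KeysCaseTwo L),
        letI : ∀ v : Places L, MeasurableSpace (Gqs L v ⧸ Subgroup.center (Gqs L v)) := fun _ => borel _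
        haveI : ∀ v : Places L, BorelSpace (Gqs L v ⧸ Subgroup.center (Gqs L v)) := fun _ => ⟨rfl⟩
        haveI : ∀ v : Places L, (μZ v).IsHaarMeasure := isHaar_μZ
        haveI hAut : (cmDatum L 3 (splitForm L 3)).IsAutomorphicMeasure μG := hAutG
        haveI : @SMulInvariantMeasure
            (adelicGroupData (↥(maximalRealSubfield L)) L (IsCMField.complexConj L) 3 (splitForm L 3)).Adelic
            (adelicGroupData (↥(maximalRealSubfield L)) L (IsCMField.complexConj L) 3 (splitForm L 3)).automorphicQuotient _
            (AdelicGroupData.instMeasurableSpaceAutomorphicQuotient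
              (adelicGroupData (↥(maximalRealSubfield L)) L (IsCMField.complexConj L) 3 (splitForm L 3))) μG :=
          hAut.toSMulInvariantMeasure
        letI : ∀ v : Places L, MeasurableSpace ((cmDatum L 3 (splitForm L 3)).Local v) := fun _ => borel _
        ∀ (ξ : OneDimAutRepH L) (π : ∀ v : Places L, IrrClass ((cmDatum L 3 (splitForm L 3)).Local v)),
          F0P3GlobalPacketDiscrete.cmOccursInDiscreteSpectrum L 3 (splitForm L 3) μG π →
          (∀ᶠ v in Filter.cofinite, π v = (transportAPackets ψ (xiPacketFamilyOfRecordSCD L H hH hHd μω hμu μZ (keysOfKeysCaseTwo L μω hK μZ hquad)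
            (hSCD_of_cmCharIdentityPackageTestSigned L H hH hHd μω hμu
              (finExplicitCollection L H μω (finExplicitDelta_conj_left_all L H μω) (finExplicitDelta_conj_right_all L H μω)) mH mG νG νH μZ hQ)) ξ v).πn) →
          ∀ v : Places L,
            (π v = (transportAPackets ψ (xiPacketFamilyOfRecordSCD L H hH hHd μω hμu μZ (keysOfKeysCaseTwo L μω hK μZ hquad)
              (hSCD_of_cmCharIdentityPackageTestSigned L H hH hHd μω hμu
                (finExplicitCollection L H μω (finExplicitDelta_conj_left_all L H μω) (finExplicitDelta_conj_right_all L H μω)) mH mG νG νH μZ hQ)) ξ v).πn ∨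
            (transportAPackets ψ (xiPacketFamilyOfRecordSCD L H hH hHd μω hμu μZ (keysOfKeysCaseTwo L μω hK μZ hquad)
              (hSCD_of_cmCharIdentityPackageTestSigned L H hH hHd μω hμu
                (finExplicitCollection L H μω (finExplicitDelta_conj_left_all L H μω) (finExplicitDelta_conj_right_all L H μω)) mH mG νG νH μZ hQ)) ξ v).πs =
              some (π v)) := by
  intro mH mG hcan hTH ψ hψ μG hAutG hQ hK ξ π hocc hae v
  -- the frame's measurable structures, VERBATIM as in the letter (so that synthesised instances are the letter's)
  letI : ∀ (v : Places L) (a : (cmDatum L 2 (Matrix.of fun i j : Fin 2 => if i.val + j.val + 1 = 2 then (1 : L) else 0)).Local v ×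
      (cmDatum L 1 (Matrix.of fun i j : Fin 1 => if i.val + j.val + 1 = 1 then (1 : L) else 0)).Local v),
    MeasurableSpace (((cmDatum L 2 (Matrix.of fun i j : Fin 2 => if i.val + j.val + 1 = 2 then (1 : L) else 0)).Local v ×
        (cmDatum L 1 (Matrix.of fun i j : Fin 1 => if i.val + j.val + 1 = 1 then (1 : L) else 0)).Local v) ⧸
      Subgroup.centralizer ({a} : Set ((cmDatum L 2 (Matrix.of fun i j : Fin 2 => if i.val + j.val + 1 = 2 then (1 : L) else 0)).Local v ×
        (cmDatum L 1 (Matrix.of fun i j : Fin 1 => if i.val + j.val + 1 = 1 then (1 : L) else 0)).Local v))) := fun _ _ => borel _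
  letI : ∀ (v : Places L) (γ : (cmDatum L 3 H).Local v),
      MeasurableSpace ((cmDatum L 3 H).Local v ⧸ Subgroup.centralizer ({γ} : Set ((cmDatum L 3 H).Local v))) := fun _ _ => borel _
  haveI : ∀ (v : Places L) (a : (cmDatum L 2 (Matrix.of fun i j : Fin 2 => if i.val + j.val + 1 = 2 then (1 : L) else 0)).Local v ×
      (cmDatum L 1 (Matrix.of fun i j : Fin 1 => if i.val + j.val + 1 = 1 then (1 : L) else 0)).Local v),
    BorelSpace (((cmDatum L 2 (Matrix.of fun i j : Fin 2 => if i.val + j.val + 1 = 2 then (1 : L) else 0)).Local v ×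
        (cmDatum L 1 (Matrix.of fun i j : Fin 1 => if i.val + j.val + 1 = 1 then (1 : L) else 0)).Local v) ⧸
      Subgroup.centralizer ({a} : Set ((cmDatum L 2 (Matrix.of fun i j : Fin 2 => if i.val + j.val + 1 = 2 then (1 : L) else 0)).Local v ×
        (cmDatum L 1 (Matrix.of fun i j : Fin 1 => if i.val + j.val + 1 = 1 then (1 : L) else 0)).Local v))) := fun _ _ => ⟨rfl⟩
  haveI : ∀ (v : Places L) (γ : (cmDatum L 3 H).Local v),
      BorelSpace ((cmDatum L 3 H).Local v ⧸ Subgroup.centralizer ({γ} : Set ((cmDatum L 3 H).Local v))) := fun _ _ => ⟨rfl⟩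
  letI : ∀ v : Places L, MeasurableSpace ((cmDatum L 3 H).Local v) := fun _ => borel _
  haveI : ∀ v : Places L, BorelSpace ((cmDatum L 3 H).Local v) := fun _ => ⟨rfl⟩
  letI : ∀ v : Places L, MeasurableSpace
    ((cmDatum L 2 (Matrix.of fun i j : Fin 2 => if i.val + j.val + 1 = 2 then (1 : L) else 0)).Local v ×
      (cmDatum L 1 (Matrix.of fun i j : Fin 1 => if i.val + j.val + 1 = 1 then (1 : L) else 0)).Local v) := fun _ => borel _
  haveI : ∀ v : Places L, BorelSpace
    ((cmDatum L 2 (Matrix.of fun i j : Fin 2 => if i.val + j.val + 1 = 2 then (1 : L) else 0)).Local v ×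
      (cmDatum L 1 (Matrix.of fun i j : Fin 1 => if i.val + j.val + 1 = 1 then (1 : L) else 0)).Local v) := fun _ => ⟨rfl⟩
  haveI : ∀ v : Places L, (νH v).IsHaarMeasure := isHaar_νH
  haveI : ∀ v : Places L, (νH v).IsMulRightInvariant := isRightInv_νH
  haveI : ∀ v : Places L, (νG v).IsHaarMeasure := isHaar_νG
  haveI : ∀ v : Places L, (νG v).IsMulRightInvariant := isRightInv_νG
  letI : ∀ v : Places L, MeasurableSpace (Gqs L v ⧸ Subgroup.center (Gqs L v)) := fun _ => borel _
  haveI : ∀ v : Places L, BorelSpace (Gqs L v ⧸ Subgroup.center (Gqs L v)) := fun _ => ⟨rfl⟩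
  haveI : ∀ v : Places L, (μZ v).IsHaarMeasure := isHaar_μZ
  haveI hAut : (cmDatum L 3 (qsForm L)).IsAutomorphicMeasure μG := hAutG
  -- the Φ₃-side measurable structures (the letter's `borel` on `U(Φ₃)_v`; `borel` on the regular-class quotients)
  letI : ∀ v : Places L, MeasurableSpace ((cmDatum L 3 (qsForm L)).Local v) := fun _ => borel _
  haveI : ∀ v : Places L, BorelSpace ((cmDatum L 3 (qsForm L)).Local v) := fun _ => ⟨rfl⟩
  letI : ∀ (v : Places L) (γ : (cmDatum L 3 (qsForm L)).Local v),
      MeasurableSpace ((cmDatum L 3 (qsForm L)).Local v ⧸ Subgroup.centralizer ({γ} : Set ((cmDatum L 3 (qsForm L)).Local v))) := fun _ _ => borel _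
  haveI : ∀ (v : Places L) (γ : (cmDatum L 3 (qsForm L)).Local v),
      BorelSpace ((cmDatum L 3 (qsForm L)).Local v ⧸ Subgroup.centralizer ({γ} : Set ((cmDatum L 3 (qsForm L)).Local v))) := fun _ _ => ⟨rfl⟩
  -- (1) `ψ_v` is matrix conjugation (`hψ`), hence a form congruence `e_S⁻¹` (★ L0)
  choose S hS using hψ
  have hL0 := fun w : Places L => exists_formCongr_of_conj L w H hH hHd (ψ w) (S w) (hS w)
  choose m hm hσm h' hψe using hL0
  -- the same presentation in the `Ad(T₂)` currency of ★ `exists_transportAPackets_xiPacketFamilyOfRecordSCD_eq` (`T₂ := S⁻¹`)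
  have h'q : ∀ w : Places L, formCongr (conjLocal L (IsCMField.complexConj L) w) (S w) (H.map (algebraMap L (LocalRing L w))) =
      m w • (qsForm L).map (algebraMap L (LocalRing L w)) := h'
  have hψT : ∀ w : Places L, ∃ (T₂ : GL (Fin 3) (LocalRing L w)) (a₂ : LocalRing L w) (ha₂ : IsUnit a₂)
      (h₂ : formCongr (conjLocal L (IsCMField.complexConj L) w) T₂ ((qsForm L).map (algebraMap L (LocalRing L w))) =
        a₂ • H.map (algebraMap L (LocalRing L w))),
      ∀ g, ψ w g = cmDatumLocalCongr L w T₂ ha₂ h₂ g := fun w =>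
    ⟨(S w)⁻¹, _, ((hm w).unit⁻¹).isUnit, formCongr_inv_eq_smul_of_formCongr_eq_smul (S w) (hm w) _ _ (h'q w), fun g => by
      rw [hψe w]
      refine Subtype.ext ?_
      change (S w)⁻¹ * g.val * S w = (S w)⁻¹ * g.val * (S w)⁻¹⁻¹
      rw [inv_inv]⟩
  -- (2) the transported H-record is the Φ₃-record for the transported datum `hSC₀`
  obtain ⟨hSC₀, heq, hshape⟩ := exists_transportAPackets_xiPacketFamilyOfRecordSCD_eq L H hH hHd
    (F0P3cStCharTSCharField.qsForm_map_cmConjRingHom_transpose L) (F0P3cStCharTSShellOrbitalG.isUnit_det_qsForm L) μω hμu μZ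
    (keysOfKeysCaseTwo L μω hK μZ hquad)
    (hSCD_of_cmCharIdentityPackageTestSigned L H hH hHd μω hμu
      (finExplicitCollection L H μω (finExplicitDelta_conj_left_all L H μω) (finExplicitDelta_conj_right_all L H μω)) mH mG νG νH μZ hQ)
    ψ hψT
  have heq' : ∀ (ξ' : OneDimAutRepH L) (w : Places L),
      transportAPackets ψ (xiPacketFamilyOfRecordSCD L H hH hHd μω hμu μZ (keysOfKeysCaseTwo L μω hK μZ hquad)
        (hSCD_of_cmCharIdentityPackageTestSigned L H hH hHd μω hμu
          (finExplicitCollection L H μω (finExplicitDelta_conj_left_all L H μω) (finExplicitDelta_conj_right_all L H μω)) mH mG νG νH μZ hQ)) ξ' w =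
      xiPacketFamilyOfRecordSCD L (qsForm L) (F0P3cStCharTSCharField.qsForm_map_cmConjRingHom_transpose L)
        (F0P3cStCharTSShellOrbitalG.isUnit_det_qsForm L) μω hμu μZ (keysOfKeysCaseTwo L μω hK μZ hquad) hSC₀ ξ' w := fun ξ' w => heq ξ' w
  rw [heq'] at ⊢
  have hae' := hae.mono fun w (hw : π w = _) => (heq' ξ w ▸ hw :
    π w = (xiPacketFamilyOfRecordSCD L (qsForm L) (F0P3cStCharTSCharField.qsForm_map_cmConjRingHom_transpose L)
      (F0P3cStCharTSShellOrbitalG.isUnit_det_qsForm L) μω hμu μZ (keysOfKeysCaseTwo L μω hK μZ hquad) hSC₀ ξ w).πn)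
  -- (3) print's Φ₃-side data, manufactured from the frame by transport along `e_S`
  haveI hHaar₀ : ∀ w : Places L, ((νG w).map (cmDatumLocalCongr L w (S w) (hm w) (h' w)).symm).IsHaarMeasure := fun w =>
    ContinuousMulEquiv.isHaarMeasure_map (νG w) (cmDatumLocalCongr L w (S w) (hm w) (h' w)).symm
  haveI hRI₀ : ∀ w : Places L, ((νG w).map (cmDatumLocalCongr L w (S w) (hm w) (h' w)).symm).IsMulRightInvariant := fun w =>
    R90.S9.isMulRightInvariant_map_cmDatumLocalCongr_symm L H w (S w) (hm w) (h' w) (νG w)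
  have hcan₀ : ∀ w : Places L, (mH w).IsCanonical (IsLocalGRegular L w) (νH w) ∧
      ((mG w).transport (cmDatumLocalCongr L w (S w) (hm w) (h' w)).symm.toMulEquiv (cmDatumLocalCongr L w (S w) (hm w) (h' w)).symm.continuous
        (cmDatumLocalCongr L w (S w) (hm w) (h' w)).continuous).IsCanonical
        (fun γ => IsRegularElt (γ.val : GL (Fin 3) (UnitaryGroup.LocalRing L w))) ((νG w).map (cmDatumLocalCongr L w (S w) (hm w) (h' w)).symm) :=
    fun w => ⟨(hcan w).1, R90.S9.isCanonical_transport_cmDatumLocalCongr_symm L H w (S w) (hm w) (h' w) (νG w) _ rfl (hcan w).2⟩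
  -- «Q♯ at the datum»: the letter's own SIGNED package `hQ` rides the frames `(S_w, m_w)` to the manufactured Φ₃-data (★ S9 `cmCharIdentityPackageTestSigned_transport_formCongr`)
  have hQ₀ := R90.S9.cmCharIdentityPackageTestSigned_transport_formCongr L H hH hHd S m hm hσm h' mH mG νG νH μω hμu hQ
  -- «(T_v) at the datum»: transfer existence at `H` (`hTH`) rides the same frames (★ S3 `isLocalDeltaTransferExists_finExplicit_transport_iff_formSignAt`, every finite place)
  have hex₀ : ∀ w : Places L, (∀ w' : PlacesOver L w, IsCMField.complexConj L • w'.1 = w'.1) →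
      IsLocalDeltaTransferExists L (qsForm L) w
        ((finExplicitCollection L (qsForm L) μω (finExplicitDelta_conj_left_all L (qsForm L) μω) (finExplicitDelta_conj_right_all L (qsForm L) μω)) w) (mH w)
        ((mG w).transport (cmDatumLocalCongr L w (S w) (hm w) (h' w)).symm.toMulEquiv (cmDatumLocalCongr L w (S w) (hm w) (h' w)).symm.continuous
          (cmDatumLocalCongr L w (S w) (hm w) (h' w)).continuous)
        Literature.NumberTheory.Rogawski1990.IsLocSmooth Literature.NumberTheory.Rogawski1990.IsLocSmooth := fun w hns =>
    (R90.S3.isLocalDeltaTransferExists_finExplicit_transport_iff_formSignAt L w H (S w) (hm w) (h' w) hH hHd μω (mH w) (mG w)).1 (hTH w hns)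
  -- ★ the PER-DATUM junction `qsRigidCoreAt_of_S5` at these data (its four leading measurable-structure binders are synthesised here, from the letter's `borel` choices)
  have hQs := qsRigidCoreAt_of_S5 hRig hAe L
  refine @hQs
    (finExplicitCollection L (qsForm L) μω (finExplicitDelta_conj_left_all L (qsForm L) μω) (finExplicitDelta_conj_right_all L (qsForm L) μω))
    mH
    (fun w => (mG w).transport (cmDatumLocalCongr L w (S w) (hm w) (h' w)).symm.toMulEquiv (cmDatumLocalCongr L w (S w) (hm w) (h' w)).symm.continuous
      (cmDatumLocalCongr L w (S w) (hm w) (h' w)).continuous)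
    (fun w => (νG w).map (cmDatumLocalCongr L w (S w) (hm w) (h' w)).symm) νH
    _ _ _ _ hHaar₀ hRI₀ _ _ μω hμu hμω rfl hcan₀ hQ₀ hex₀ _ _ μZ _ hK hquad hSC₀ (fun ξ' w hns T' a ha h π2 πn hk hn => ?_) μG hAut ξ π hocc hae' v
  -- the PIN `hSCid` for the transported datum: the H-side signed identity of `hQ` rides `e_S` (★ `charIdentityAtTest_transport_of_frames`)
  obtain ⟨T₁, a₁, ha₁, h₁, hval⟩ := hshape ξ' w hns T' a ha h π2 πn hk hn
  rw [hval, hψe w, ContinuousMulEquiv.symm_symm]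
  exact charIdentityAtTest_transport_of_frames L H w μω hns hH hHd (S w) (hm w) (h' w) (mH w) (mG w) (νG w) (νH w) (ξ'.xiLocalChar w)
    T₁ a₁ ha₁ h₁ T' a ha h πn _
    (charIdentityAtTestSigned_hSCD L H hH hHd μω hμu
      (finExplicitCollection L H μω (finExplicitDelta_conj_left_all L H μω) (finExplicitDelta_conj_right_all L H μω)) mH mG νG νH μZ hQ
      ξ' w hns T₁ a₁ ha₁ h₁ π2 πn hk hn)


end Summit.HodgeConjecture.HodgeConjecture.R90.S7

end
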